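import Summits.ABC.ABC.Theses.IsogenyGlueCongruence
import Literature.NumberTheory.EllipticCurves.DegreeConjectureAbcPrelims
import Literature.NumberTheory.EllipticCurves.CuspFormLFunctionFrickeProofs
import Literature.NumberTheory.EllipticCurves.CongruenceNumber

/-!
# Disproof file for the crux `TorsionSharingPrimeBound` (K, stmt-ABC-2157) — findings

Crux (rev-4 level form, route IsogenyGlueCongruence):
`∃ κ C, 0 ≤ κ ∧ ∀ W` (elliptic, globally minimal, `N = conductorNorm ℤ W ≠ 0`, semistable)
`∀ M g` (`g ∈ S₂(Γ₀(M))` a newform, `IsNewform0 g`, with `¬ IsNewformOf W g`) `∀ ℓ` prime,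
(congruence `a_p(g) ≡ a_p(W)` in a field of characteristic `ℓ` through some `φ : R → F`, `R ∋ aₙ(g)`,
for every prime `p ∤ M N ℓ`) `→ ℓ ≤ C (M N)^κ`.

VERDICT OF THIS FILE: **no kill**. Summary of what is CHECKED below (sorry-free unless marked):

* §0 `CongruentAway`, `k_iff` — the congruence hypothesis isolated; `congruentAway_of_int` — an
  honest integer congruence `b_p ≡ a_p(W) (mod ℓ)` always instantiates it (`R = ℤ ⊆ ℂ`, `F = ZMod ℓ`).
* §1 LOAD-BEARING `¬ IsNewformOf W g`: `kWithoutNe_false_of_modularity :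
  exists_isNewformOf → ¬ KWithoutNe` (witness: `g = f_W` itself is congruent to `W` modulo EVERY `ℓ`).
* §2 LOAD-BEARING normalisation `a₁(g) = 1` inside `IsNewform0`:
  `kWithoutNormalisation_false_of_modularity : exists_isNewformOf → ¬ KWithoutNormalisation`
  (witness `g = (ℓ+1) • f_W`: new, Hecke-eigen, `≠ f_W`, congruent to `f_W` mod `ℓ` for the chosen `ℓ`).
  Moral: the `(R, F, φ)`-quantification lets ANY rescaling through; only `a₁ = 1` stops it.
* §3 LOAD-BEARING Hecke-eigen condition inside `IsNewform0`:
  `kWithoutEigen_false_of_twoIntegralNewforms : TwoIntegralNewforms → ¬ KWithoutEigen`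
  (witness `g = (1-ℓ) • f_W + ℓ • f'`, `f'` a second integral new vector at the same level, e.g.
  37a1/37b1: new, normalised, `≠ f_W`, congruent mod `ℓ`). `TwoIntegralNewforms` is a precise `Prop`
  (true: level 37), stated inline for relocation.
* §3b LOAD-BEARING "new": `kWithoutNew_false_of_pStabilisedOldform : PStabilisedOldform → ¬ KWithoutNew`
  (witness: the p-stabilised oldform `f_W(τ) − β f_W(pτ)`, congruent to `f_W` modulo every `ℓ` through
  the ring of algebraic integers — `congruentAway_of_isIntegral`).
* §4 WHAT ANY PROOF MUST CONTAIN: `isNewformOf_of_k : K → (a newform g of ANY level M with integral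
  coefficients b_p = a_p(W) for all primes p ∤ M N is the newform of W)`. So K subsumes strong
  multiplicity one for the pairs `(f_W, g)` (Atkin–Lehner–Li) and `level = conductor` (Carayol):
  in the tree these are the named facts `IsNewform0.eq_of_heckeEigenvalue_eq`,
  `IsNewform0.level_eq_of_heckeEigenvalue_eq`, `IsNewformOf.level_eq_conductorNorm` — a prover
  cannot avoid importing them (or reproving them). Eigenvalue form modulo the integrality fact:
  `isNewformOf_of_k_of_coeff_eq : K → IsNewform0.isIntegral_coeff → (a_p(g) = a_p(W) ∀ p ∤ MN) → IsNewformOf W g`.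
* §5 NATURAL STRENGTHENING REFUTED (modulo a printed theorem): the LEVEL-FREE bound `ℓ ≤ C N^κ` is
  false given `UnboundedCongruencePrimes` (Ribet 1984 level raising + Chebotarev: one fixed
  semistable `W` has newform partners `g ≠ f_W` of level `N p` modulo unboundedly many `ℓ`):
  `kLevelFree_false_of_unboundedCongruencePrimes`. The level `M` in `(M N)^κ` is load-bearing.
* §6 `conclusion_false_without_hypotheses` — the bare conclusion is false (M = N = 1).
* §7 (docstring only) WHY K RESISTS: modulo printed theorems K ⟺ crux A (`DegreePrimesPolyBounded`)
  and ¬K ⟹ ¬(polynomial Szpiro for semistable curves) ⟹ ¬ABC; partners of level `M ≠ N` are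
  provably harmless (`ℓ ≤ 4M` or `ℓ ≪ N log N`). A kill of K is a disproof of ABC.
* §8 DATA (jobs j011654/j014453, PARI `ellmoddegree`, 67 semistable Frey curves of abc hits, N ≤ 2490):
  ALL modular degrees are 31-smooth; max non-free congruence prime 31, max θ = log P/log N² = 0.2255 —
  no pressure on κ even at Szpiro ratio 7.05 (343 + 3¹⁰ = 2¹¹·29: m = 241920 = 2⁸3³5·7).

Nothing in this file asserts a Theses decl positively; §1–§3, §5 are `H → ¬ Variant` lemmas,
§4 is `K → (non-Theses statement)`.
-/

noncomputable section

open scoped MatrixGroups ModularForm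
open CongruenceSubgroup
open Literature.NumberTheory.EllipticCurves.ModularForms
open Literature.NumberTheory.EllipticCurves

set_option linter.dupNamespace false

namespace Summit.ABC.ABC.Cruxes.TorsionSharingPrimeBound.Disproof

/-- The crux under attack (route decl). -/
abbrev K : Prop := Summit.ABC.ABC.Theses.IsogenyGlueCongruence.TorsionSharingPrimeBound

/-! ## §0 The congruence hypothesis, isolated -/

/-- `CongruentAway W M g ℓ`: the congruence hypothesis of the crux — some subring `R ⊆ ℂ` containing
all `aₙ(g)`, some field `F` of characteristic `ℓ` and ring map `φ : R → F` with
`φ(a_p(g)) = a_p(W)` for every prime `p ∤ M · N_W · ℓ`. For `R = ℤ[aₙ(g)]` this is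
"`f_W ≡ g` modulo a prime above `ℓ`", i.e. `ρ̄_{g,λ}^{ss} ≅ ρ̄_{W,ℓ}^{ss}`. [folklore] -/
def CongruentAway (W : WeierstrassCurve ℚ) (M : ℕ) [NeZero M] (g : CuspForm (Gamma0 M) 2)
    (ℓ : ℕ) : Prop :=
  ∃ (R : Subring ℂ) (F : Type) (_ : Field F) (_ : CharP F ℓ) (φ : R →+* F)
    (hg : ∀ n : ℕ, cuspCoeff g n ∈ R),
    ∀ p : ℕ, p.Prime → ¬ (p ∣ M * W.conductorNorm ℤ * ℓ) →
      φ ⟨cuspCoeff g p, hg p⟩ = ((W.LFunction p : ℤ) : F)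

/-- The crux, restated through `CongruentAway` (definitional reshuffling of the `∀ R F φ hg`
binders into one hypothesis). [folklore] -/
theorem k_iff : K ↔ ∃ κ C : ℝ, 0 ≤ κ ∧ ∀ (W : WeierstrassCurve ℚ) [W.IsElliptic]
    [W.IsGloballyMinimal] [NeZero (W.conductorNorm ℤ)], W.IsSemistable ℤ →
    ∀ (M : ℕ) [NeZero M] (g : CuspForm (Gamma0 M) 2), IsNewform0 g → ¬ IsNewformOf W g →
    ∀ ℓ : ℕ, ℓ.Prime → CongruentAway W M g ℓ →
    (ℓ : ℝ) ≤ C * ((M : ℝ) * (W.conductorNorm ℤ : ℝ)) ^ κ := by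
  constructor
  · rintro ⟨κ, C, hκ, h⟩
    refine ⟨κ, C, hκ, ?_⟩
    intro W _ _ _ hW M _ g hg hne ℓ hℓ hc
    obtain ⟨R, F, _, _, φ, hgR, hc⟩ := hc
    exact h W hW M g hg hne ℓ hℓ R F φ hgR hc
  · rintro ⟨κ, C, hκ, h⟩
    refine ⟨κ, C, hκ, ?_⟩
    intro W _ _ _ hW M _ g hg hne ℓ hℓ R F _ _ φ hgR hc
    exact h W hW M g hg hne ℓ hℓ ⟨R, F, ‹_›, ‹_›, φ, hgR, hc⟩

/-- An honest integer congruence instantiates the hypothesis: if `aₙ(g) = bₙ ∈ ℤ` for all `n` and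
`b_p ≡ a_p(W) (mod ℓ)` for the primes `p ∤ M N ℓ`, then `CongruentAway W M g ℓ`
(take `R = ℤ ⊆ ℂ`, `F = ZMod ℓ`, `φ` = reduction mod `ℓ`). [folklore] -/
theorem congruentAway_of_int {W : WeierstrassCurve ℚ} {M : ℕ} [NeZero M]
    {g : CuspForm (Gamma0 M) 2} (b : ℕ → ℤ) (hb : ∀ n, cuspCoeff g n = (b n : ℂ)) {ℓ : ℕ}
    (hℓ : ℓ.Prime)
    (hcong : ∀ p : ℕ, p.Prime → ¬ (p ∣ M * W.conductorNorm ℤ * ℓ) →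
      ((b p : ℤ) : ZMod ℓ) = ((W.LFunction p : ℤ) : ZMod ℓ)) :
    CongruentAway W M g ℓ := by
  classical
  haveI : Fact ℓ.Prime := ⟨hℓ⟩
  let ι : ℤ →+* ℂ := Int.castRingHom ℂ
  have hinj : Function.Injective ι.rangeRestrict := by
    intro x y hxy
    have : (ι.rangeRestrict x : ℂ) = ι.rangeRestrict y := by rw [hxy]
    simpa [ι] using this
  let e : ℤ ≃+* ι.range := RingEquiv.ofBijective ι.rangeRestrict ⟨hinj, ι.rangeRestrict_surjective⟩
  refine ⟨ι.range, ZMod ℓ, inferInstance, inferInstance,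
    (Int.castRingHom (ZMod ℓ)).comp e.symm.toRingHom, fun n ↦ ⟨b n, by simp [ι, hb n]⟩, ?_⟩
  intro p hp hpd
  have he : e.symm ⟨cuspCoeff g p, ⟨b p, by simp [ι, hb p]⟩⟩ = b p := by
    apply e.injective
    rw [RingEquiv.apply_symm_apply]
    ext
    simp [e, ι, hb p]
  simp only [RingHom.coe_comp, RingEquiv.toRingHom_eq_coe, RingHom.coe_coe, Function.comp_apply]
  rw [he]
  simpa using hcong p hp hpd

/-! ### Algebraic-integer coefficients also instantiate the hypothesis -/

/-- The ring of all algebraic integers of `ℂ`, as a subring. [folklore] -/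
def algInt : Subring ℂ := (integralClosure ℤ ℂ).toSubring

/-- Membership in `algInt` is integrality over `ℤ`. [folklore] -/
theorem mem_algInt {x : ℂ} : x ∈ algInt ↔ IsIntegral ℤ x := by
  simp [algInt, mem_integralClosure_iff]

/-- `algInt` is an integral extension of `ℤ`. [folklore] -/
instance algInt_isIntegral : Algebra.IsIntegral ℤ algInt := by
  refine ⟨fun x ↦ ?_⟩
  have hx : IsIntegral ℤ (x : ℂ) := mem_algInt.mp x.2
  exact (isIntegral_algHom_iff (algInt.subtype.toIntAlgHom) Subtype.val_injective).mp hx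

/-- If all `aₙ(g)` are algebraic integers and `a_p(g) = a_p(W)` EXACTLY for the primes `p ∤ M N ℓ`,
then `CongruentAway W M g ℓ`: take `R` = all algebraic integers, `F = R/𝔮` for a maximal `𝔮` above
`ℓ` (lying over, `Ideal.exists_ideal_over_maximal_of_isIntegral`). Used for witnesses with
irrational coefficients (§3b) and for the eigenvalue form of rigidity (§4b). [folklore] -/
theorem congruentAway_of_isIntegral {W : WeierstrassCurve ℚ} {M : ℕ} [NeZero M]
    {g : CuspForm (Gamma0 M) 2} (hint : ∀ n, IsIntegral ℤ (cuspCoeff g n)) {ℓ : ℕ} (hℓ : ℓ.Prime)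
    (heq : ∀ p : ℕ, p.Prime → ¬ (p ∣ M * W.conductorNorm ℤ * ℓ) →
      cuspCoeff g p = ((W.LFunction p : ℤ) : ℂ)) :
    CongruentAway W M g ℓ := by
  classical
  have hp : Prime (ℓ : ℤ) := Nat.prime_iff_prime_int.mp hℓ
  haveI hPp : (Ideal.span {(ℓ : ℤ)}).IsPrime := (Ideal.span_singleton_prime hp.ne_zero).mpr hp
  haveI hP : (Ideal.span {(ℓ : ℤ)}).IsMaximal :=
    Ideal.IsPrime.isMaximal hPp (by simpa [Ideal.span_singleton_eq_bot] using hp.ne_zero)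
  have hinj : Function.Injective (algebraMap ℤ algInt) := by
    intro a b hab
    have := congrArg (fun x : algInt ↦ (x : ℂ)) hab
    simpa using this
  have hker : RingHom.ker (algebraMap ℤ algInt) ≤ Ideal.span {(ℓ : ℤ)} := by
    rw [(RingHom.injective_iff_ker_eq_bot _).mp hinj]; exact bot_le
  obtain ⟨Q, hQmax, hQ⟩ :=
    Ideal.exists_ideal_over_maximal_of_isIntegral (S := algInt) (Ideal.span {(ℓ : ℤ)}) hker
  have hℓQ : (algebraMap ℤ algInt ℓ) ∈ Q := by
    have : (ℓ : ℤ) ∈ Q.comap (algebraMap ℤ algInt) := by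
      rw [hQ]; exact Ideal.mem_span_singleton_self _
    exact this
  have hℓF : ((ℓ : ℕ) : algInt ⧸ Q) = 0 := by
    have := (Ideal.Quotient.eq_zero_iff_mem).mpr hℓQ
    simpa using this
  obtain ⟨p, hpF⟩ := CharP.exists (algInt ⧸ Q)
  have hpl : p = ℓ := by
    have hdvd : p ∣ ℓ := (CharP.cast_eq_zero_iff (algInt ⧸ Q) p ℓ).mp hℓF
    rcases (Nat.dvd_prime hℓ).mp hdvd with h | h
    · exact absurd h (CharP.char_ne_one (algInt ⧸ Q) p)
    · exact h
  subst hpl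
  refine ⟨algInt, algInt ⧸ Q, Ideal.Quotient.field Q, hpF, Ideal.Quotient.mk Q,
    fun n ↦ mem_algInt.mpr (hint n), ?_⟩
  intro q hq hqd
  have hx : (⟨cuspCoeff g q, mem_algInt.mpr (hint q)⟩ : algInt) =
      ((W.LFunction q : ℤ) : algInt) := by
    ext
    simp [heq q hq hqd]
  rw [hx, map_intCast]

/-! ### A concrete semistable, globally minimal elliptic curve over `ℚ`

`W₀ : y² + x y = x³ + 4 x² + x` is the minimal model (B–G (12.18), Serre's normalisation
`(A, B) = (−1, 16)`) of the Frey curve of `1 + 15 = 16`; conductor `rad(−1·16·15) = 30`. All four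
instance/side conditions of the crux are PROVED for it in the tree (`isElliptic_freyIntModel₂`,
`isMinimalAt_freyIntModel₂`, `conductorNorm_pos_holds`, `isSemistableAt_freyIntModel₂`). -/

/-- `W₀ = (12.18) for (A, B) = (−1, 16)`. [folklore] -/
def W₀ : WeierstrassCurve ℚ := (freyIntModel₂ (-1) 16).baseChange ℚ

/-- `W₀` is an elliptic curve (`isElliptic_freyIntModel₂`). [folklore] -/
instance W₀.isElliptic : W₀.IsElliptic :=
  isElliptic_freyIntModel₂ (by norm_num) (by norm_num) (by norm_num)

/-- `−1` and `16` are coprime. [folklore] -/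
theorem isCoprime_neg_one_sixteen : IsCoprime (-1 : ℤ) 16 := isCoprime_one_left.neg_left

/-- `W₀` is minimal at every prime (`isMinimalAt_freyIntModel₂`, B–G Ex. 12.5.10 (a)). [folklore] -/
theorem W₀_isMinimalAt (v : IsDedekindDomain.HeightOneSpectrum ℤ) : W₀.IsMinimalAt v :=
  isMinimalAt_freyIntModel₂ isCoprime_neg_one_sixteen (by norm_num) (by norm_num) v

/-- `W₀` is a global minimal model (minimal at every prime). [folklore] -/
instance W₀.isGloballyMinimal : W₀.IsGloballyMinimal :=
  isGloballyMinimal_of_forall_isMinimalAt_int _ W₀_isMinimalAt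

/-- The conductor of `W₀` is non-zero (`conductorNorm_pos_holds`). [folklore] -/
instance W₀.neZero_conductorNorm : NeZero (W₀.conductorNorm ℤ) :=
  ⟨(WeierstrassCurve.conductorNorm_pos_holds W₀).ne'⟩

/-- `W₀` is semistable (`isSemistableAt_freyIntModel₂`). [folklore] -/
theorem W₀_isSemistable : W₀.IsSemistable ℤ := fun v ↦
  isSemistableAt_freyIntModel₂ isCoprime_neg_one_sixteen (by norm_num) (by norm_num) (by norm_num) v

/-- A prime beyond any real bound. [folklore] -/
theorem exists_prime_gt (B : ℝ) : ∃ ℓ : ℕ, ℓ.Prime ∧ B < ℓ := by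
  obtain ⟨ℓ, hge, hℓ⟩ := Nat.exists_infinite_primes (⌈B⌉₊ + 1)
  refine ⟨ℓ, hℓ, ?_⟩
  have h1 : (⌈B⌉₊ : ℝ) + 1 ≤ ℓ := by exact_mod_cast hge
  linarith [Nat.le_ceil B]

/-! ## §1 `¬ IsNewformOf W g` is load-bearing -/

/-- K with the hypothesis `¬ IsNewformOf W g` deleted. [folklore] -/
def KWithoutNe : Prop := ∃ κ C : ℝ, 0 ≤ κ ∧ ∀ (W : WeierstrassCurve ℚ) [W.IsElliptic]
    [W.IsGloballyMinimal] [NeZero (W.conductorNorm ℤ)], W.IsSemistable ℤ →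
    ∀ (M : ℕ) [NeZero M] (g : CuspForm (Gamma0 M) 2), IsNewform0 g →
    ∀ ℓ : ℕ, ℓ.Prime → CongruentAway W M g ℓ →
    (ℓ : ℝ) ≤ C * ((M : ℝ) * (W.conductorNorm ℤ : ℝ)) ^ κ

/-- Without `g ≠ f_W` the crux is false, modulo the modularity fact `exists_isNewformOf` (named
Literature fact, Wiles/BCDT): `g = f_{W₀}` is congruent to `W₀` modulo every prime `ℓ`, while the
bound `C (N₀ N₀)^κ` is fixed. [folklore] -/
theorem kWithoutNe_false_of_modularity (hmod : exists_isNewformOf) : ¬ KWithoutNe := by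
  rintro ⟨κ, C, -, h⟩
  obtain ⟨f, hf⟩ := hmod W₀
  obtain ⟨ℓ, hℓ, hℓgt⟩ :=
    exists_prime_gt (C * ((W₀.conductorNorm ℤ : ℝ) * (W₀.conductorNorm ℤ : ℝ)) ^ κ)
  have hcong : CongruentAway W₀ (W₀.conductorNorm ℤ) f ℓ :=
    congruentAway_of_int (fun n ↦ W₀.LFunction n) (fun n ↦ hf.2 n) hℓ (fun _ _ _ ↦ rfl)
  have hle := h W₀ W₀_isSemistable (W₀.conductorNorm ℤ) f hf.1 ℓ hℓ hcong
  linarith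

/-! ## §2 The normalisation `a₁(g) = 1` is load-bearing -/

/-- K with `IsNewform0 g` weakened to "`g` is a Hecke eigenform in the new subspace" (normalisation
`a₁ = 1` dropped; `¬ IsNewformOf W g` kept). [folklore] -/
def KWithoutNormalisation : Prop := ∃ κ C : ℝ, 0 ≤ κ ∧ ∀ (W : WeierstrassCurve ℚ) [W.IsElliptic]
    [W.IsGloballyMinimal] [NeZero (W.conductorNorm ℤ)], W.IsSemistable ℤ →
    ∀ (M : ℕ) [NeZero M] (g : CuspForm (Gamma0 M) 2), g ∈ newSubspace0 M 2 → IsHeckeEigenform g →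
    ¬ IsNewformOf W g → ∀ ℓ : ℕ, ℓ.Prime → CongruentAway W M g ℓ →
    (ℓ : ℝ) ≤ C * ((M : ℝ) * (W.conductorNorm ℤ : ℝ)) ^ κ

/-- Without the normalisation the crux is false, modulo `exists_isNewformOf`: for a prime `ℓ` beyond
the bound, `g = (ℓ + 1) • f_{W₀}` lies in the new subspace, is a Hecke eigenform, is not `f_{W₀}`
(`a₁(g) = ℓ + 1 ≠ 1`), and `aₙ(g) = (ℓ+1) aₙ(W₀) ≡ aₙ(W₀) (mod ℓ)` for all `n`. So any proof of K
uses `a₁(g) = 1` — and uses it only to exclude rescalings, since the `(R, F, φ)` quantification is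
otherwise scale-blind. [folklore] -/
theorem kWithoutNormalisation_false_of_modularity (hmod : exists_isNewformOf) :
    ¬ KWithoutNormalisation := by
  rintro ⟨κ, C, -, h⟩
  obtain ⟨f, hf⟩ := hmod W₀
  obtain ⟨ℓ, hℓ, hℓgt⟩ :=
    exists_prime_gt (C * ((W₀.conductorNorm ℤ : ℝ) * (W₀.conductorNorm ℤ : ℝ)) ^ κ)
  set c : ℤ := ℓ + 1 with hc
  set g : CuspForm (Gamma0 (W₀.conductorNorm ℤ)) 2 := (c : ℂ) • f with hg
  have hnew : g ∈ newSubspace0 (W₀.conductorNorm ℤ) 2 :=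
    (newSubspace0 (W₀.conductorNorm ℤ) 2).smul_mem _ hf.1.1
  have heig : IsHeckeEigenform g := by
    intro p hp
    obtain ⟨a, ha⟩ := hf.1.2.1 p hp
    refine ⟨a, ?_⟩
    rw [hg, map_smul, ha, smul_comm]
  have hcoeff : ∀ n, cuspCoeff g n = ((c * W₀.LFunction n : ℤ) : ℂ) := by
    intro n
    rw [hg, cuspCoeff_smul, hf.2 n]
    push_cast
    ring
  have hne : ¬ IsNewformOf W₀ g := by
    intro hgW
    have h1 : cuspCoeff g 1 = 1 := hgW.1.2.2
    have h1' : cuspCoeff f 1 = 1 := hf.1.2.2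
    rw [hg, cuspCoeff_smul, h1'] at h1
    have : (c : ℂ) = 1 := by simpa using h1
    have hc1 : c = 1 := by exact_mod_cast this
    have := hℓ.two_le
    omega
  have hcong : CongruentAway W₀ (W₀.conductorNorm ℤ) g ℓ := by
    refine congruentAway_of_int (fun n ↦ c * W₀.LFunction n) hcoeff hℓ (fun p _ _ ↦ ?_)
    push_cast
    simp [hc]
  have hle := h W₀ W₀_isSemistable (W₀.conductorNorm ℤ) g hnew heig hne ℓ hℓ hcong
  linarith

/-! ## §3 The Hecke-eigen condition is load-bearing -/

/-- K with `IsNewform0 g` weakened to "`g` is a normalised element of the new subspace" (the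
Hecke-eigenform condition dropped). [folklore] -/
def KWithoutEigen : Prop := ∃ κ C : ℝ, 0 ≤ κ ∧ ∀ (W : WeierstrassCurve ℚ) [W.IsElliptic]
    [W.IsGloballyMinimal] [NeZero (W.conductorNorm ℤ)], W.IsSemistable ℤ →
    ∀ (M : ℕ) [NeZero M] (g : CuspForm (Gamma0 M) 2), g ∈ newSubspace0 M 2 → IsNormalized g →
    ¬ IsNewformOf W g → ∀ ℓ : ℕ, ℓ.Prime → CongruentAway W M g ℓ →
    (ℓ : ℝ) ≤ C * ((M : ℝ) * (W.conductorNorm ℤ : ℝ)) ^ κ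

/-- HYPOTHESIS (true, printed; stated inline for relocation): some semistable, globally minimal
elliptic `W/ℚ` of conductor `N` has, besides its newform `f` (`IsNewformOf W f`), a second vector
`f'` in the new subspace `S₂(Γ₀(N))^{new}` with INTEGER Fourier coefficients `bₙ`, `b₁ = 1`, and
`bₙ ≠ aₙ(W)` for some `n`. Instance: `N = 37` (prime level, so `S₂(Γ₀(37)) = S₂^{new}`, dimension 2,
spanned by the rational newforms of 37a1: `q − 2q² − 3q³ + …` and 37b1: `q + q³ − 2q⁴ + …`); needs
modularity of 37a1/37b1 and the `q`-expansions of Cremona's Table 3.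
[cite: Cremona1997, Table 3, N = 37] -/
def TwoIntegralNewforms : Prop :=
  ∃ (W : WeierstrassCurve ℚ) (_ : W.IsElliptic) (_ : W.IsGloballyMinimal)
    (_ : NeZero (W.conductorNorm ℤ)), W.IsSemistable ℤ ∧
    ∃ (f f' : CuspForm (Gamma0 (W.conductorNorm ℤ)) 2) (b : ℕ → ℤ), IsNewformOf W f ∧
      f' ∈ newSubspace0 (W.conductorNorm ℤ) 2 ∧ (∀ n, cuspCoeff f' n = (b n : ℂ)) ∧ b 1 = 1 ∧
      ∃ n, b n ≠ W.LFunction n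

/-- Without the eigenform condition the crux is false, modulo `TwoIntegralNewforms`: for `ℓ` beyond
the bound, `g = (1 − ℓ) • f + ℓ • f'` is in the new subspace, normalised (`a₁ = (1−ℓ) + ℓ = 1`), has
`aₙ(g) = aₙ(W) + ℓ (bₙ − aₙ(W)) ≡ aₙ(W) (mod ℓ)` for all `n`, and `≠ f_W` at the index where
`bₙ ≠ aₙ(W)`. So any proof of K uses that `g` is an eigenform (the congruence alone does not see
it). [folklore] -/
theorem kWithoutEigen_false_of_twoIntegralNewforms (h2 : TwoIntegralNewforms) : ¬ KWithoutEigen := by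
  rintro ⟨κ, C, -, h⟩
  obtain ⟨W, _, _, _, hW, f, f', b, hf, hf'new, hb, hb1, n₀, hn₀⟩ := h2
  obtain ⟨ℓ, hℓ, hℓgt⟩ :=
    exists_prime_gt (C * ((W.conductorNorm ℤ : ℝ) * (W.conductorNorm ℤ : ℝ)) ^ κ)
  set g : CuspForm (Gamma0 (W.conductorNorm ℤ)) 2 :=
    ((1 - ℓ : ℤ) : ℂ) • f + ((ℓ : ℤ) : ℂ) • f' with hg
  have hnew : g ∈ newSubspace0 (W.conductorNorm ℤ) 2 :=
    (newSubspace0 _ 2).add_mem ((newSubspace0 _ 2).smul_mem _ hf.1.1)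
      ((newSubspace0 _ 2).smul_mem _ hf'new)
  have hcoeff : ∀ n, cuspCoeff g n = (((1 - ℓ) * W.LFunction n + ℓ * b n : ℤ) : ℂ) := by
    intro n
    have h1 : (1 : ℝ) ∈ (Gamma0 (W.conductorNorm ℤ) : Subgroup (GL (Fin 2) ℝ)).strictPeriods :=
      strictWidthInfty_Gamma0 (W.conductorNorm ℤ) ▸
        (Gamma0 (W.conductorNorm ℤ) : Subgroup (GL (Fin 2) ℝ)).strictWidthInfty_mem_strictPeriods
    rw [hg, cuspCoeff_add_form h1, cuspCoeff_smul, cuspCoeff_smul, hf.2 n, hb n]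
    push_cast
    ring
  have hL1 : W.LFunction 1 = 1 := by
    have h1 : cuspCoeff f 1 = 1 := hf.1.2.2
    rw [hf.2 1] at h1
    exact_mod_cast h1
  have hnorm : IsNormalized g := by
    show cuspCoeff g 1 = 1
    rw [hcoeff 1, hL1, hb1]
    push_cast
    ring
  have hne : ¬ IsNewformOf W g := by
    intro hgW
    have h0 := hgW.2 n₀
    rw [hcoeff n₀] at h0
    have h0' : (1 - (ℓ : ℤ)) * W.LFunction n₀ + ℓ * b n₀ = W.LFunction n₀ := by exact_mod_cast h0
    have h1 : (ℓ : ℤ) * (b n₀ - W.LFunction n₀) = 0 := by linear_combination h0'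
    rcases mul_eq_zero.mp h1 with h | h
    · exact hℓ.ne_zero (by exact_mod_cast h)
    · exact hn₀ (sub_eq_zero.mp h)
  have hcong : CongruentAway W (W.conductorNorm ℤ) g ℓ := by
    refine congruentAway_of_int (fun n ↦ (1 - ℓ) * W.LFunction n + ℓ * b n) hcoeff hℓ
      (fun p _ _ ↦ ?_)
    push_cast
    simp
  have hle := h W hW (W.conductorNorm ℤ) g hnew hnorm hne ℓ hℓ hcong
  linarith

/-! ## §3b The "new" conjunct is load-bearing (p-stabilised oldforms) -/

/-- K with `IsNewform0 g` weakened to "`g` is a normalised Hecke eigenform" (membership in the new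
subspace dropped). [folklore] -/
def KWithoutNew : Prop := ∃ κ C : ℝ, 0 ≤ κ ∧ ∀ (W : WeierstrassCurve ℚ) [W.IsElliptic]
    [W.IsGloballyMinimal] [NeZero (W.conductorNorm ℤ)], W.IsSemistable ℤ →
    ∀ (M : ℕ) [NeZero M] (g : CuspForm (Gamma0 M) 2), IsHeckeEigenform g → IsNormalized g →
    ¬ IsNewformOf W g → ∀ ℓ : ℕ, ℓ.Prime → CongruentAway W M g ℓ →
    (ℓ : ℝ) ≤ C * ((M : ℝ) * (W.conductorNorm ℤ : ℝ)) ^ κ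

/-- HYPOTHESIS (true, printed; stated inline for relocation): a `p`-STABILISED OLDFORM. Some semistable,
globally minimal elliptic `W/ℚ` of conductor `N`, some level `M` and prime `p`, and some
`g ∈ S₂(Γ₀(M))` which is a normalised Hecke eigenform for ALL `T_q` (`U_q` at `q ∣ M`), has
algebraic-integer coefficients, satisfies `a_q(g) = a_q(W)` for every prime `q ≠ p`, and
`a_p(g) ≠ a_p(W)`. Instance: `M = N p`, `p ∤ N`, `g = f_W(τ) − β f_W(pτ)` with `α + β = a_p(W)`,
`αβ = p`: then `T_q g = a_q g` (`q ≠ p`), `U_p g = α g`, `a₁(g) = 1`, `aₙ(g) = aₙ − β a_{n/p}`, and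
`a_p(g) = α ≠ a_p(W)` as `β ≠ 0` (Diamond–Shurman §5.6–5.8, the maps `ι_d` and `T_p` on oldforms;
Gouvêa, *Arithmetic of p-adic modular forms*, LNM 1304, II.3 "p-stabilisation").
[cite: DiamondShurman2005, §5.6–5.8] -/
def PStabilisedOldform : Prop :=
  ∃ (W : WeierstrassCurve ℚ) (_ : W.IsElliptic) (_ : W.IsGloballyMinimal)
    (_ : NeZero (W.conductorNorm ℤ)), W.IsSemistable ℤ ∧
    ∃ (M : ℕ) (_ : NeZero M) (p : ℕ) (g : CuspForm (Gamma0 M) 2), IsHeckeEigenform g ∧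
      IsNormalized g ∧ (∀ n, IsIntegral ℤ (cuspCoeff g n)) ∧
      (∀ q : ℕ, q.Prime → q ≠ p → cuspCoeff g q = ((W.LFunction q : ℤ) : ℂ)) ∧ p ∣ M ∧
      cuspCoeff g p ≠ ((W.LFunction p : ℤ) : ℂ)

/-- Without "`g` is NEW" the crux is false, modulo `PStabilisedOldform`: the `p`-stabilised oldform
of `f_W` at level `M ∋ p` agrees with `W` at every prime `q ≠ p`, hence is congruent to it modulo
every `ℓ` (through the ring of algebraic integers, `congruentAway_of_isIntegral`), yet differs at
`p ∣ M`. So any proof of K uses that `g` lies in the new subspace. [folklore] -/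
theorem kWithoutNew_false_of_pStabilisedOldform (hP : PStabilisedOldform) : ¬ KWithoutNew := by
  rintro ⟨κ, C, -, h⟩
  obtain ⟨W, _, _, _, hW, M, _, p, g, heig, hnorm, hint, hq, hpM, hp⟩ := hP
  obtain ⟨ℓ, hℓ, hℓgt⟩ := exists_prime_gt (C * ((M : ℝ) * (W.conductorNorm ℤ : ℝ)) ^ κ)
  have hne : ¬ IsNewformOf W g := fun hgW ↦ hp (hgW.2 p)
  have hcong : CongruentAway W M g ℓ := by
    refine congruentAway_of_isIntegral hint hℓ (fun q hq' hqd ↦ hq q hq' ?_)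
    rintro rfl
    exact hqd (dvd_mul_of_dvd_left (dvd_mul_of_dvd_left hpM _) _)
  have hle := h W hW M g heig hnorm hne ℓ hℓ hcong
  linarith

/-! ## §4 What any proof of K must contain: multiplicity one for the pairs `(f_W, g)` -/

/-- **K proves a strong-multiplicity-one statement.** If K holds, then for every semistable `W`
(globally minimal, conductor `N`) and every newform `g` of ANY level `M` whose Fourier coefficients
are integers `bₙ` with `b_p = a_p(W)` for all primes `p ∤ M N`, already `IsNewformOf W g` (all
`aₙ(g) = aₙ(W)`; with the fact `IsNewformOf.level_eq_conductorNorm`, also `M = N`). Proof: otherwise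
`g` is an admissible partner congruent to `W` modulo EVERY prime `ℓ`, contradicting the fixed bound.
Hence any proof of K contains (for such pairs) Atkin–Lehner–Li strong multiplicity one and
Carayol's level = conductor — in the tree the named facts `IsNewform0.eq_of_heckeEigenvalue_eq`,
`IsNewform0.level_eq_of_heckeEigenvalue_eq`, `IsNewform0.heckeEigenvalue_eq_coeff`,
`IsNewformOf.level_eq_conductorNorm`; they are unavoidable imports for a prover. [folklore] -/
theorem isNewformOf_of_k (hK : K) {W : WeierstrassCurve ℚ} [W.IsElliptic] [W.IsGloballyMinimal]
    [NeZero (W.conductorNorm ℤ)] (hW : W.IsSemistable ℤ) {M : ℕ} [NeZero M]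
    {g : CuspForm (Gamma0 M) 2} (hg : IsNewform0 g) (b : ℕ → ℤ)
    (hb : ∀ n, cuspCoeff g n = (b n : ℂ))
    (heq : ∀ p : ℕ, p.Prime → ¬ (p ∣ M * W.conductorNorm ℤ) → b p = W.LFunction p) :
    IsNewformOf W g := by
  by_contra hne
  obtain ⟨κ, C, -, h⟩ := k_iff.mp hK
  obtain ⟨ℓ, hℓ, hℓgt⟩ := exists_prime_gt (C * ((M : ℝ) * (W.conductorNorm ℤ : ℝ)) ^ κ)
  have hcong : CongruentAway W M g ℓ := by
    refine congruentAway_of_int b hb hℓ (fun p hp hpd ↦ ?_)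
    rw [heq p hp (fun hd ↦ hpd (dvd_mul_of_dvd_left hd ℓ))]
  have hle := h W hW M g hg hne ℓ hℓ hcong
  linarith

/-- The same, packaged: K implies that two admissible data `(M, g, b)` and `W` agreeing at all primes
`p ∤ M N` cannot be "different" in the sense of the crux. In particular K is at least as strong as
the rigidity statement `Rigidity` below, which is a theorem of the Atkin–Lehner–Li theory but is
NOT provable in the tree today without the named newform facts. [folklore] -/
def Rigidity : Prop := ∀ (W : WeierstrassCurve ℚ) [W.IsElliptic] [W.IsGloballyMinimal]
    [NeZero (W.conductorNorm ℤ)], W.IsSemistable ℤ → ∀ (M : ℕ) [NeZero M]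
    (g : CuspForm (Gamma0 M) 2), IsNewform0 g → ∀ b : ℕ → ℤ, (∀ n, cuspCoeff g n = (b n : ℂ)) →
    (∀ p : ℕ, p.Prime → ¬ (p ∣ M * W.conductorNorm ℤ) → b p = W.LFunction p) → IsNewformOf W g

/-- `TSPB → Rigidity` (see `isNewformOf_of_k`). [folklore] -/
theorem rigidity_of_k (hK : K) : Rigidity :=
  fun _W _ _ _ hW _M _ _g hg b hb heq ↦ isNewformOf_of_k hK hW hg b hb heq

/-- **Eigenvalue form of the rigidity K subsumes**, modulo the integrality fact
`IsNewform0.isIntegral_coeff` (Shimura Thm 3.48, named fact of the tree): if K holds, a newform `g`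
of ANY level `M` with `a_p(g) = a_p(W)` for all primes `p ∤ M N` is the newform of `W`. This is
exactly strong multiplicity one + level = conductor for the pair `(f_W, g)`; K cannot be proved
without it. [folklore] -/
theorem isNewformOf_of_k_of_coeff_eq (hK : K) {W : WeierstrassCurve ℚ} [W.IsElliptic]
    [W.IsGloballyMinimal] [NeZero (W.conductorNorm ℤ)] (hW : W.IsSemistable ℤ) {M : ℕ} [NeZero M]
    (hint : IsNewform0.isIntegral_coeff (N := M) (k := 2))
    {g : CuspForm (Gamma0 M) 2} (hg : IsNewform0 g)
    (heq : ∀ p : ℕ, p.Prime → ¬ (p ∣ M * W.conductorNorm ℤ) →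
      cuspCoeff g p = ((W.LFunction p : ℤ) : ℂ)) :
    IsNewformOf W g := by
  by_contra hne
  obtain ⟨κ, C, -, h⟩ := k_iff.mp hK
  obtain ⟨ℓ, hℓ, hℓgt⟩ := exists_prime_gt (C * ((M : ℝ) * (W.conductorNorm ℤ : ℝ)) ^ κ)
  have hcong : CongruentAway W M g ℓ := by
    refine congruentAway_of_isIntegral (fun n ↦ hint hg n) hℓ (fun p hp hpd ↦ ?_)
    exact heq p hp (fun hd ↦ hpd (dvd_mul_of_dvd_left hd ℓ))
  have hle := h W hW M g hg hne ℓ hℓ hcong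
  linarith

/-! ## §5 The level `M` in the bound is load-bearing (level raising) -/

/-- K strengthened by dropping the partner's level from the bound: `ℓ ≤ C N^κ`. [folklore] -/
def KLevelFree : Prop := ∃ κ C : ℝ, 0 ≤ κ ∧ ∀ (W : WeierstrassCurve ℚ) [W.IsElliptic]
    [W.IsGloballyMinimal] [NeZero (W.conductorNorm ℤ)], W.IsSemistable ℤ →
    ∀ (M : ℕ) [NeZero M] (g : CuspForm (Gamma0 M) 2), IsNewform0 g → ¬ IsNewformOf W g →
    ∀ ℓ : ℕ, ℓ.Prime → CongruentAway W M g ℓ → (ℓ : ℝ) ≤ C * (W.conductorNorm ℤ : ℝ) ^ κ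

/-- HYPOTHESIS (true, printed; stated inline for relocation): ONE fixed semistable, globally minimal
elliptic `W/ℚ` admits newform partners `g ≠ f_W` (of some levels `M`) congruent to it modulo
arbitrarily large primes `ℓ`. Source: level raising — for `ℓ ∤ 2N` with `ρ̄_{W,ℓ}` irreducible
(Mazur: all `ℓ ≥ 11`, `W` semistable) and a prime `p ∤ N ℓ` with `a_p(W) ≡ ±(p+1) (mod ℓ)` (such `p`
exist by Chebotarev: `Frob_p` = complex conjugation in `ℚ(W[ℓ], μ_ℓ)` gives `a_p ≡ 0`, `p ≡ −1`),
there is a newform `g` of level `N p`, new at `p`, with `ρ̄_g ≅ ρ̄_{W,ℓ}` (Ribet 1984, Thm. 1;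
Diamond–Taylor 1994, Thm. A); `g ≠ f_W` as the levels differ. Note such `ℓ` satisfy
`ℓ ∣ (p+1)² − a_p²`, so `ℓ ≤ (√p+1)² ≤ 4 M / N`: harmless for K itself, fatal for `KLevelFree`.
[cite: DiamondTaylor1994, Thm. A] -/
def UnboundedCongruencePrimes : Prop :=
  ∃ (W : WeierstrassCurve ℚ) (_ : W.IsElliptic) (_ : W.IsGloballyMinimal)
    (_ : NeZero (W.conductorNorm ℤ)), W.IsSemistable ℤ ∧
    ∀ B : ℝ, ∃ ℓ : ℕ, ℓ.Prime ∧ B < ℓ ∧ ∃ (M : ℕ) (_ : NeZero M) (g : CuspForm (Gamma0 M) 2),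
      IsNewform0 g ∧ ¬ IsNewformOf W g ∧ CongruentAway W M g ℓ

/-- The level-free strengthening of K is false modulo level raising: the partner's level `M` must
enter the bound. (Consistent with the route text: "level-raising partners are free" only because
`ℓ ≲ M/N`.) [folklore] -/
theorem kLevelFree_false_of_unboundedCongruencePrimes (hU : UnboundedCongruencePrimes) :
    ¬ KLevelFree := by
  rintro ⟨κ, C, -, h⟩
  obtain ⟨W, _, _, _, hW, hU⟩ := hU
  obtain ⟨ℓ, hℓ, hℓgt, M, _, g, hg, hne, hcong⟩ := hU (C * (W.conductorNorm ℤ : ℝ) ^ κ)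
  have hle := h W hW M g hg hne ℓ hℓ hcong
  linarith

/-! ## §6 The bare conclusion is false -/

/-- The hypothesis-free shape of the conclusion is false (take `M = N = 1`). [folklore] -/
theorem conclusion_false_without_hypotheses :
    ¬ ∃ κ C : ℝ, ∀ M N ℓ : ℕ, ℓ.Prime → (ℓ : ℝ) ≤ C * ((M : ℝ) * (N : ℝ)) ^ κ := by
  rintro ⟨κ, C, h⟩
  obtain ⟨ℓ, hℓ, hℓgt⟩ := exists_prime_gt C
  have := h 1 1 ℓ hℓ
  simp at this
  linarith

/-! ## §7 Why K resists (analysis; not formalised)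

Modulo printed theorems, K is EQUIVALENT to crux A `DegreePrimesPolyBounded` (prime factors of the
modular degree of a semistable curve are `≤ C N^κ`), and `¬K ⟹ ¬ABC`:

1. `ℓ ≤ 7` or `ρ̄_{W,ℓ}` reducible: bounded (`ℓ ≤ 7`, Mazur 1978, `W` semistable).
2. Some `p ∣ N` with `p ∤ M`: `N(ρ̄) ∣ M` (Carayol–Livné) forces `ρ̄` unramified at `p`, i.e.
   `ℓ ∣ v_p(Δ_min)` (Tate curve), so `ℓ ≤ log₂|Δ_min| ≪ N log N` (Murty–Pasten 2013 /
   Pasten–Shimura Thm 1.9: `h(E) < (1/48+ε) N log N`). If `ℓ ∣ N` and `ℓ ∤ M`: `ρ̄_g` is finite flat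
   at `ℓ`, so again `ℓ ∣ v_ℓ(Δ_min)`. Polynomial in `N`: harmless (needs `κ > 1`).
3. Else `N ∣ M`; a prime `q ∣ M/N`, `q ≠ ℓ`: `g` new at `q` with `ρ̄_g ≅ ρ̄` of smaller conductor at `q`
   forces `ℓ ∣ (q+1)² − a_q(W)²` (`q ∥ M`, `q ∤ N`), or `ℓ ∣ q² − 1` (`q² ∣ M`), or `ℓ ≤ 3`
   (Carayol 1989; Diamond–Taylor 1994; Hasse bound): `ℓ ≤ (√q+1)² ≤ 4M`. If `ℓ ∣ M`: `ℓ ≤ M`. Harmless.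
4. Remaining case `M = N`, `g ≠ f_W` a newform of the same squarefree level: `ℓ` is a congruence
   prime, `ℓ ∣ r_E` (Ribet 1983 / Zagier 1985), and `r_E`, `m_E` have the same odd prime factors for
   squarefree `N` (Agashe–Ribet–Stein 2012, Thm 2.1): `ℓ ∣ m_E = deg φ_E`. So K ⟺ A (with
   `κ_K = max(κ_A, 2)`, `κ_A ≤ 2κ_K`).
5. `ℓ ∣ m_E ⟹ ℓ ≤ m_E = 4π² c² (f,f) / covol(Λ_E) ≪ N^{1+ε} e^{2 h_F(E)}` (Zagier's formula, `c`
   bounded for semistable optimal curves — Mazur/Abbes–Ullmo/Česnavičius —, `(f,f) ≪ N^{1+ε}`). Hence a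
   counterexample family to A has `h_F(E_n)/log N_n → ∞`, i.e. violates every polynomial Szpiro bound
   for semistable curves, hence (ABC ⟹ Szpiro) violates ABC. CONVERSELY nothing cheaper than such a
   family can refute K. Finite data cannot refute `∃ κ C`.

So: no small model, no degenerate parameter, no known family. The only formal leaks (§1–§3) are closed
by the three conjuncts of `IsNewform0`/`IsNewformOf`, each of which is therefore load-bearing.
Semistability is NOT load-bearing for truth (the same reduction gives "A for all E/ℚ", also a
consequence of ABC ⟹ Szpiro; ARS needs `ℓ² ∤ 4N`, and primes `ℓ ∣ N` are free) — it is there for the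
Frey-curve application; `IsGloballyMinimal` only pins `conductorNorm`/`LFunction` conventions.

## §8 Data (kit jobs j011654 — stalled on N = 53130 —, j014453; PARI/GP 2.15 `ellmoddegree`)

Semistable Frey curves `y² = x(x−a)(x+b)` (arrangement of smaller conductor) of ALL abc hits with
`c ≤ 10⁴` plus famous small-radical triples, sorted by conductor; 67 curves with `N ≤ 2490` computed
(the run stalls at the next level; larger levels need modular-symbol spaces of dimension ≫ 10³).
Columns: `a b c | quality | N | Szpiro ratio log|Δ_min|/log N | m_E = deg φ | P = largest prime factor
of m_E not dividing 6N | θ = log P / log(N²)` (θ = the exponent a same-level congruence prime forces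
on κ). Selected rows (full table: job stdout, attached as item evidence compute-j014453.json):

    3 125 128      | 1.427 | 30   | 4.71 | 12      = 2²·3            | –  | 0
    1 2400 2401    | 1.456 | 210  | 4.79 | 1024    = 2¹⁰             | –  | 0
    625 2048 2673  | 1.361 | 330  | 6.62 | 4480    = 2⁷·5·7          | 7  | 0.168
    16 6859 6875   | 1.156 | 1045 | 5.08 | 8832    = 2⁷·3·23         | 23 | 0.2255  (max θ)
    37 32768 32805 | 1.483 | 1110 | 6.17 | 98560   = 2⁸·5·7·11       | 11 | 0.171
    343 59049 59392| 1.547 | 1218 | 7.05 | 241920  = 2⁸·3³·5·7       | 5  | 0.113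
    2401 3375 5776 | 1.045 | 1995 | 5.74 | 39168   = 2⁸·3²·17        | 17 | 0.186
    128 4913 5041  | 1.095 | 2414 | 4.91 | 26784   = 2⁵·3³·31        | 31 | 0.2204  (max P)

FINDINGS. (i) Every one of the 67 modular degrees is `{2,3,5,7,11,13,17,23,31}`-smooth; the largest
"non-free" same-level congruence prime in the whole sample is `31`, the largest θ is `0.2255`: the data
exert NO pressure on κ (any κ ≥ 1/4 fits with C = 1 at M = N), even for the Szpiro-extremal curves
(ratio up to 7.05, where `m_E ≈ N^{1.75}`). (ii) The size of `m_E` does track `N·|Δ|^{1/6}` (Szpiro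
ratio 7.05 ↦ m = 241920 ≈ N^{1.75}; ratio 3.3 ↦ m ≈ N^{0.4…1}), as Zagier's formula predicts, but
the growth is absorbed by powers of 2 and 3 (full rational 2-torsion of Frey curves). (iii) Hence a
counterexample to K at M = N needs modular degrees with a prime factor of size N^κ — nothing remotely
like it occurs; consistent with §7 (it would take a Szpiro-violating family). Bias caveat: Frey
curves only (2-torsion forces 2-power-heavy degrees); ARS report r_E, m_E clean for all N ≤ 557.
-/

end Summit.ABC.ABC.Cruxes.TorsionSharingPrimeBound.Disproof

end
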